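import Literature.NumberTheory.Automorphic.SphericalEigencharacterStarCharacter
import HarnessLib

/-!
# Finite products of spherical Hecke eigencharacters over finitely supported families of local test functions
(`f^{S∧}(t) = ∏_{v ∈ T} t_v(f_v)` is padding-invariant, multiplicative, `*`-compatible and unital — the generic core of
«`⊗_{v∉S} 𝓗_v` is a unital `*`-algebra on which the e.v.p.'s of automorphic origin are `*`-characters»)

Topic `NumberTheory/Automorphic`; namespace `Literature.NumberTheory.Automorphic.IrrClass`.  Support file: proved theorems only; no named fact, no
definition, no instance, no `sorry`.  Over ★ `SphericalEigencharacterStarCharacter` (one place: `t(f ⋆ g) = μ(K) t(f) t(g)`, `t(f^*) = \overline{t(f)}`,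
`t(a • f) = a t(f)`) and ★ `SmoothCharacterUnitaryBound` (`t(𝟙_K) = 1`), this file does the `Finset` bookkeeping of the RESTRICTED TENSOR PRODUCT
[Flath1979 §2–§3; CartierCorvallis1979 §IV.1; Rogawski1990 §13.7 p. 206]: a family of places `i : ι`, groups `G i` with left-invariant Borel measures `μ i`
finite on compacts and compact open subgroups `K i`; a «finitely supported family» is `F : ∀ i, G i → ℂ` with `F i ∈ C_c(K_i\G_i/K_i)` and `F i = 𝟙_{K_i}`
off a declared finite set `T`; its value at a family of eigencharacters `t = (t_i)` is `∏_{i ∈ T} t_i(F_i)`.  For families `t` of eigencharacters of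
ADMISSIBLE `K_i`-SPHERICAL classes `c i` (★ `IrrClass.IsSphericalWith (c i) (K i) (μ i) (t i)`, `μ_i(K_i) ≠ 0`):

* `prod_apply_eq_prod_apply_of_eq_indicator_off` — PADDING INVARIANCE: the product over any two declared supports of the same family agree
  (`t_i(𝟙_{K_i}) = 1`, ★ `apply_indicator_eq_one`);
* `prod_apply_inv_smul_mulConv` — PRODUCT: `∏_{T₁ ∪ T₂} t_i(μ_i(K_i)⁻¹ • (F_i ⋆ G_i)) = (∏_{T₁} t_i(F_i)) · (∏_{T₂} t_i(G_i))`
  (★ `apply_inv_smul_mulConv` placewise, then padding);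
* `prod_apply_mulStar` — STAR (classes moreover UNITARIZABLE, `μ i` inversion-invariant): `∏_T t_i(F_i^*) = \overline{∏_T t_i(F_i)}` (★ `apply_mulStar`);
* `prod_apply_indicator` — UNIT: `∏_T t_i(𝟙_{K_i}) = 1`.

These are the three conjuncts of the cell's law (L1-iii) `UnrStarAlgebra` (and the padding lemma behind `Factorisation`'s consistency) for germs of classes,
uniformly in the family of classes; the consumer instantiates `ι` = finite places of `L⁺`, `G i = U(H)(L⁺_v)`, `K i = U(H)(𝒪_v)`.  HC_CM is proved only modulo
the printed citations until rung 0 closes; nothing here is specific to it.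

## References
* D. Flath, *Decomposition of representations into tensor products*, PSPM 33.1 (1979), §2–§3. [Flath1979]
* P. Cartier, *Representations of p-adic groups: a survey*, PSPM 33.1 (1979), §IV.1. [CartierCorvallis1979]
* J. D. Rogawski, *Automorphic Representations of Unitary Groups in Three Variables* (1990), §13.7 p. 206. [Rogawski1990]
-/

set_option autoImplicit false

open MeasureTheory Literature.NumberTheory.Automorphic
open scoped ComplexConjugate

namespace Literature.NumberTheory.Automorphic.IrrClass

universe u v

variable {ι : Type u} [DecidableEq ι] {G : ι → Type v} [∀ i, TopologicalSpace (G i)] [∀ i, Group (G i)]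
  [∀ i, IsTopologicalGroup (G i)] [∀ i, MeasurableSpace (G i)] (K : ∀ i, Subgroup (G i)) (μ : ∀ i, Measure (G i))

omit [DecidableEq ι] in
/-- **UNIT**: `∏_{i ∈ T} t_i(𝟙_{K_i}) = 1` for eigencharacters of `K_i`-spherical classes (★ `apply_indicator_eq_one` placewise).
[cite: CartierCorvallis1979, §IV.1 Cor. 4.1] [cite: Flath1979, §2] -/
theorem prod_apply_indicator (T : Finset ι) {c : ∀ i, IrrClass (G i)} {t : ∀ i, (G i → ℂ) → ℂ}
    (hsph : ∀ i ∈ T, (c i).IsSphericalWith (K i) (μ i) (t i)) (hKo : ∀ i, IsOpen (K i : Set (G i)))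
    (hKc : ∀ i, IsCompact (K i : Set (G i))) (hμK : ∀ i, (μ i).real (K i : Set (G i)) ≠ 0) :
    ∏ i ∈ T, t i ((K i : Set (G i)).indicator fun _ => (1 : ℂ)) = 1 :=
  Finset.prod_eq_one fun i hi => (hsph i hi).apply_indicator_eq_one (μ i) (hKo i) (hKc i) (hμK i)

/-- **PADDING INVARIANCE** [Flath1979 §2 (restricted tensor products: inserting the distinguished vectors `𝟙_{K_i}` does not change the tensor)]: if the
family `F` equals `𝟙_{K_i}` off `T` and off `T'`, then `∏_{T} t_i(F_i) = ∏_{T'} t_i(F_i)` for eigencharacters of `K_i`-spherical classes on `T ∪ T'`.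
[cite: Flath1979, §2] [cite: CartierCorvallis1979, §IV.1 Cor. 4.1] -/
theorem prod_apply_eq_prod_apply_of_eq_indicator_off {T T' : Finset ι} {F : ∀ i, G i → ℂ} {c : ∀ i, IrrClass (G i)}
    {t : ∀ i, (G i → ℂ) → ℂ} (hsph : ∀ i ∈ T ∪ T', (c i).IsSphericalWith (K i) (μ i) (t i)) (hKo : ∀ i, IsOpen (K i : Set (G i)))
    (hKc : ∀ i, IsCompact (K i : Set (G i))) (hμK : ∀ i, (μ i).real (K i : Set (G i)) ≠ 0)
    (hF : ∀ i, i ∉ T → F i = (K i : Set (G i)).indicator fun _ => (1 : ℂ))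
    (hF' : ∀ i, i ∉ T' → F i = (K i : Set (G i)).indicator fun _ => (1 : ℂ)) :
    ∏ i ∈ T, t i (F i) = ∏ i ∈ T', t i (F i) := by
  classical
  have aux : ∀ A B : Finset ι, A ∪ B = T ∪ T' → (∀ i, i ∉ A → F i = (K i : Set (G i)).indicator fun _ => (1 : ℂ)) →
      ∏ i ∈ A, t i (F i) = ∏ i ∈ A ∪ B, t i (F i) := by
    intro A B hAB hA
    refine Finset.prod_subset Finset.subset_union_left fun i hi hiA => ?_
    rw [hA i hiA]
    exact (hsph i (hAB ▸ hi)).apply_indicator_eq_one (μ i) (hKo i) (hKc i) (hμK i)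
  rw [aux T T' rfl hF, aux T' T (Finset.union_comm T' T) hF', Finset.union_comm]

section Product

variable [∀ i, BorelSpace (G i)] [∀ i, (μ i).IsMulLeftInvariant] [∀ i, IsFiniteMeasureOnCompacts (μ i)]
  [∀ i, SecondCountableTopology (G i)] [∀ i, SFinite (μ i)]

/-- **PRODUCT** [CartierCorvallis1979 §IV.1; Flath1979 §2; Rogawski1990 §13.7 p. 206]: for two finitely supported families `F` (support `T₁`) and `G` (support
`T₂`) of level-`K_i` compactly supported factors, the family `H_i := μ_i(K_i)⁻¹ • (F_i ⋆ G_i)` satisfies, at every family of eigencharacters of ADMISSIBLE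
`K_i`-SPHERICAL classes,

  `∏_{i ∈ T₁ ∪ T₂} t_i(H_i) = (∏_{i ∈ T₁} t_i(F_i)) · (∏_{i ∈ T₂} t_i(G_i))`

(★ `IsSphericalWith.apply_inv_smul_mulConv` at each `i ∈ T₁ ∪ T₂`, then padding by `t_i(𝟙_{K_i}) = 1`).
[cite: CartierCorvallis1979, §IV.1 Cor. 4.1] [cite: Flath1979, §2] [cite: Rogawski1990, §13.7 p. 206] -/
theorem prod_apply_inv_smul_mulConv {T₁ T₂ : Finset ι} {F G' : ∀ i, G i → ℂ} {c : ∀ i, IrrClass (G i)} {t : ∀ i, (G i → ℂ) → ℂ}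
    (hadm : ∀ i ∈ T₁ ∪ T₂, (c i).IsAdmissible) (hsph : ∀ i ∈ T₁ ∪ T₂, (c i).IsSphericalWith (K i) (μ i) (t i))
    (hKo : ∀ i, IsOpen (K i : Set (G i))) (hKc : ∀ i, IsCompact (K i : Set (G i))) (hμK : ∀ i, (μ i).real (K i : Set (G i)) ≠ 0)
    (hFc : ∀ i, HasCompactSupport (F i)) (hFK : ∀ i, IsLevel (K i) (F i)) (hGc : ∀ i, HasCompactSupport (G' i))
    (hGK : ∀ i, IsLevel (K i) (G' i)) (hF : ∀ i, i ∉ T₁ → F i = (K i : Set (G i)).indicator fun _ => (1 : ℂ))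
    (hG : ∀ i, i ∉ T₂ → G' i = (K i : Set (G i)).indicator fun _ => (1 : ℂ)) :
    ∏ i ∈ T₁ ∪ T₂, t i ((((μ i).real (K i : Set (G i)) : ℂ)⁻¹) • mulConv (μ i) (F i) (G' i)) =
      (∏ i ∈ T₁, t i (F i)) * ∏ i ∈ T₂, t i (G' i) := by
  classical
  have h1 : ∏ i ∈ T₁ ∪ T₂, t i ((((μ i).real (K i : Set (G i)) : ℂ)⁻¹) • mulConv (μ i) (F i) (G' i)) =
      ∏ i ∈ T₁ ∪ T₂, (t i (F i) * t i (G' i)) :=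
    Finset.prod_congr rfl fun i hi =>
      (hsph i hi).apply_inv_smul_mulConv (μ i) (hadm i hi) (hμK i) (hFc i) (hFK i) (hGc i) (hGK i)
  have hsph' : ∀ i ∈ T₁ ∪ (T₁ ∪ T₂), (c i).IsSphericalWith (K i) (μ i) (t i) := fun i hi =>
    hsph i (by simpa [← Finset.union_assoc, Finset.union_idempotent] using hi)
  have hsph'' : ∀ i ∈ T₂ ∪ (T₁ ∪ T₂), (c i).IsSphericalWith (K i) (μ i) (t i) := fun i hi =>
    hsph i (by simpa [Finset.union_left_comm, Finset.union_idempotent] using hi)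
  rw [h1, Finset.prod_mul_distrib,
    prod_apply_eq_prod_apply_of_eq_indicator_off K μ hsph' hKo hKc hμK hF (fun i hi => hF i fun h => hi (Finset.mem_union_left _ h)),
    prod_apply_eq_prod_apply_of_eq_indicator_off K μ hsph'' hKo hKc hμK hG (fun i hi => hG i fun h => hi (Finset.mem_union_right _ h))]

end Product

omit [DecidableEq ι] in
/-- **STAR** [DeitmarEchterhoff2014 Prop. 6.2.1; CartierCorvallis1979 §IV.1; Rogawski1990 §13.7 p. 206]: at a family of eigencharacters of ADMISSIBLE
UNITARIZABLE `K_i`-SPHERICAL classes (inversion-invariant `μ_i`), `∏_{i ∈ T} t_i(F_i^*) = \overline{∏_{i ∈ T} t_i(F_i)}` (★ `IsSphericalWith.apply_mulStar`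
placewise). [cite: CartierCorvallis1979, §IV.1 Cor. 4.1] [cite: DeitmarEchterhoff2014, Prop. 6.2.1] [cite: Rogawski1990, §13.7 p. 206] -/
theorem prod_apply_mulStar [∀ i, BorelSpace (G i)] [∀ i, (μ i).IsMulLeftInvariant] [∀ i, IsFiniteMeasureOnCompacts (μ i)]
    [∀ i, (μ i).IsInvInvariant] (T : Finset ι) {F : ∀ i, G i → ℂ} {c : ∀ i, IrrClass (G i)}
    {t : ∀ i, (G i → ℂ) → ℂ} (hadm : ∀ i ∈ T, (c i).IsAdmissible) (hu : ∀ i ∈ T, (c i).IsUnitarizable)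
    (hsph : ∀ i ∈ T, (c i).IsSphericalWith (K i) (μ i) (t i)) (hμK : ∀ i, (μ i).real (K i : Set (G i)) ≠ 0)
    (hFc : ∀ i, HasCompactSupport (F i)) (hFK : ∀ i, IsLevel (K i) (F i)) :
    ∏ i ∈ T, t i (mulStar (F i)) = conj (∏ i ∈ T, t i (F i)) := by
  rw [map_prod]
  exact Finset.prod_congr rfl fun i hi => (hsph i hi).apply_mulStar (μ i) (hadm i hi) (hu i hi) (hμK i) (hFc i) (hFK i)

/-- **STAR preserves finitely supported families**: `(𝟙_{K})^* = 𝟙_{K}`. [cite: CartierCorvallis1979, §IV.1] -/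
theorem _root_.Literature.NumberTheory.Automorphic.mulStar_indicator_subgroup {H : Type*} [Group H] (K₀ : Subgroup H) :
    mulStar ((K₀ : Set H).indicator fun _ => (1 : ℂ)) = (K₀ : Set H).indicator fun _ => (1 : ℂ) := by
  funext g
  rw [mulStar_apply]
  by_cases hg : g ∈ (K₀ : Set H)
  · rw [Set.indicator_of_mem hg, Set.indicator_of_mem (show g⁻¹ ∈ (K₀ : Set H) from K₀.inv_mem hg), map_one]
  · have hg' : g⁻¹ ∉ (K₀ : Set H) := fun h => hg (by simpa using K₀.inv_mem h)
    rw [Set.indicator_of_notMem hg, Set.indicator_of_notMem hg', map_zero]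

end Literature.NumberTheory.Automorphic.IrrClass
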